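import Mathlib
import HarnessLib
import Literature.MathematicalPhysics.StatisticalMechanics.ComplexGradientStiffness
import Summits.HubbardSuperconductivity.HubbardSuperconductivity.Theorems.ComplexGFFStiffnessDefs
import Summits.HubbardSuperconductivity.HubbardSuperconductivity.Theorems.ComplexGFFStiffnessHypACumulantPertZBasic

/-!
# Crux `HypALocalTwoPoint`, line `gnv` — translation invariance of the perturbed one-point functions

Route `route-HubbardSuperconductivity-ComplexGFFStiffness`, crux item stmt-HubbardSuperconductivity-19155
(`…Theses.ComplexGFFStiffness.HypALocalTwoPoint`), registered stub `stub_twoPointGivenZ : TwoPointGivenZ`.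
First piece of the reduction of the stub to the Lipschitz continuity of translation-averaged one-point
functions (`…Theorems.ComplexGFF.OnePointLipschitz`): on the torus `Λ = (ℤ/n)^4` the perturbed weight
`e^{−S_0(φ)} ∏_y (1 + K(∇φ(y)))` of a single-site gradient perturbation `K` and Lebesgue measure are
invariant under the translations `φ ↦ φ(· + a)`, so the one-point function `∫ G(∇φ(x)) · weight` of a local
gradient observable `G` does not depend on the site `x`, and the site sum is `|Λ|` times any one of them.
For the model (`K = pertK g`, weight `= w_{g,0}`, `pertZ n (pertK g) = Z_n(g,0)`) this expresses the
expectation `ev n g (G(∇φ(x)))` of `TwoPointGivenZ` through the perturbed partition-function integrals.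

## Contents (all proved; no definition, no named fact)
* `integral_comp_equiv`, `integral_comp_addRight` — `∫ F(φ ∘ e) dφ = ∫ F(φ) dφ` on `ℝ^Λ` for a
  bijection / translation `e` of the sites; `D_comp_addRight`, `S_zero_comp_addRight`,
  `prod_one_add_siteShift` — the gradient, the free action and the perturbation product are translation
  covariant / invariant;
* `integral_obs_mul_weight_eq` — `∫ G(∇φ(x))·e^{−S_0}∏(1+K) = ∫ G(∇φ(y))·e^{−S_0}∏(1+K)` for all sites;
* `integral_sum_obs_mul_weight` — `∫ (Σ_x G(∇φ(x)))·e^{−S_0}∏(1+K) = |Λ| · ∫ G(∇φ(x₀))·e^{−S_0}∏(1+K)`;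
* `ev_gradObs_eq_div_pertZ` — `ev n g (G(∇φ(x))) = (∫ G(∇φ(x))·e^{−S_0}∏(1+𝒦_g)) / pertZ n 𝒦_g`.

## References
* S. Adams, S. Buchholz, R. Kotecký, S. Müller, arXiv:1910.13564, Sec. 2.1 (translation-invariant
  finite-volume states on the tori `(ℤ/L^N)^d`) [AdamsBuchholzKoteckyMuller2019].
-/

noncomputable section

-- `Summit.<Summit>.<Problem>`: single-conjunct summit, the duplicate component is mandated (D-0017).
set_option linter.dupNamespace false

namespace Summit.HubbardSuperconductivity.HubbardSuperconductivity.Theorems.ComplexGFF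

open scoped BigOperators ComplexConjugate
open MeasureTheory
open Literature.MathematicalPhysics.StatisticalMechanics.ComplexGradientGFF4 (Z ev D S w)

variable {n : ℕ}

/-! ### Translations of the torus act on fields, gradients, the action and the weight -/

/-- relabelling the sites by a bijection of the torus preserves the Lebesgue integral on `ℝ^Λ`
(complex-valued integrands; junk-compatible: both sides vanish together when `F` is not integrable). -/
theorem integral_comp_equiv [NeZero n] (e : (Fin 4 → ZMod n) ≃ (Fin 4 → ZMod n))
    (F : ((Fin 4 → ZMod n) → ℝ) → ℂ) :
    ∫ φ : (Fin 4 → ZMod n) → ℝ, F (fun s => φ (e s)) = ∫ φ : (Fin 4 → ZMod n) → ℝ, F φ := by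
  have h := (MeasureTheory.volume_measurePreserving_piCongrLeft
    (fun _ : Fin 4 → ZMod n => ℝ) e).integral_comp' (g := fun φ => F (fun s => φ (e s)))
  simp only [MeasurableEquiv.piCongrLeft_apply_apply] at h
  exact h.symm

/-- **Lebesgue measure on `ℝ^Λ` is translation invariant**: for every `a ∈ Λ` and every integrand
`F`, `∫ F(φ(· + a)) dφ = ∫ F(φ) dφ`. -/
theorem integral_comp_addRight [NeZero n] (a : Fin 4 → ZMod n)
    (F : ((Fin 4 → ZMod n) → ℝ) → ℂ) :
    ∫ φ : (Fin 4 → ZMod n) → ℝ, F (fun s => φ (s + a)) = ∫ φ : (Fin 4 → ZMod n) → ℝ, F φ :=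
  integral_comp_equiv (Equiv.addRight a) F

/-- the forward gradient commutes with translations: `∂_i(φ(· + a))(s) = ∂_iφ(s + a)`. -/
theorem D_comp_addRight (φ : (Fin 4 → ZMod n) → ℝ) (a : Fin 4 → ZMod n) (i : Fin 4)
    (s : Fin 4 → ZMod n) : D (fun t => φ (t + a)) i s = D φ i (s + a) := by
  unfold D
  simp only [add_right_comm s (Pi.single i (1 : ZMod n)) a]

/-- `S_0` is translation invariant. -/
theorem S_zero_comp_addRight [NeZero n] (φ : (Fin 4 → ZMod n) → ℝ) (a : Fin 4 → ZMod n) :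
    S 0 (fun t => φ (t + a)) = S 0 φ := by
  rw [S_zero_eq, S_zero_eq]
  simp only [D_comp_addRight]
  have h1 : ∑ s : Fin 4 → ZMod n, ∑ i : Fin 4, (D φ i (s + a)) ^ 2
      = ∑ s : Fin 4 → ZMod n, ∑ i : Fin 4, (D φ i s) ^ 2 :=
    Fintype.sum_equiv (Equiv.addRight a) _ _ (fun s => rfl)
  have h2 : ∑ s : Fin 4 → ZMod n, φ (s + a) = ∑ s : Fin 4 → ZMod n, φ s :=
    Fintype.sum_equiv (Equiv.addRight a) _ _ (fun s => rfl)
  rw [h1, h2]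

/-- the single-site perturbation product is translation invariant (reindexing the sites):
`∏_x (1 + K(∇φ(x + a))) = ∏_x (1 + K(∇φ(x)))`. -/
theorem prod_one_add_siteShift [NeZero n] (K : (Fin 4 → ℝ) → ℂ) (φ : (Fin 4 → ZMod n) → ℝ)
    (a : Fin 4 → ZMod n) :
    ∏ x : Fin 4 → ZMod n, (1 + K (fun i => D φ i (x + a)))
      = ∏ x : Fin 4 → ZMod n, (1 + K (fun i => D φ i x)) :=
  Fintype.prod_equiv (Equiv.addRight a) _ _ (fun _ => rfl)

/-! ### One-point functions do not depend on the site -/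

/-- **Translation invariance of the one-point functions**: for every local gradient observable `G`,
perturbation `K` and sites `x, y`,
`∫ G(∇φ(x)) e^{−S_0(φ)}∏_z(1+K(∇φ(z))) dφ = ∫ G(∇φ(y)) e^{−S_0(φ)}∏_z(1+K(∇φ(z))) dφ`. -/
theorem integral_obs_mul_weight_eq [NeZero n] (K G : (Fin 4 → ℝ) → ℂ) (x y : Fin 4 → ZMod n) :
    ∫ φ : (Fin 4 → ZMod n) → ℝ, G (fun i => D φ i x) *
        (Complex.exp (-((S 0 φ : ℝ) : ℂ)) * ∏ z : Fin 4 → ZMod n, (1 + K (fun i => D φ i z)))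
      = ∫ φ : (Fin 4 → ZMod n) → ℝ, G (fun i => D φ i y) *
        (Complex.exp (-((S 0 φ : ℝ) : ℂ)) * ∏ z : Fin 4 → ZMod n, (1 + K (fun i => D φ i z))) := by
  -- translate by `a = x - y`: `∇(φ(·+a))(y) = ∇φ(y + a) = ∇φ(x)`
  have h := integral_comp_addRight (n := n) (x - y)
    (fun φ => G (fun i => D φ i y) *
      (Complex.exp (-((S 0 φ : ℝ) : ℂ)) * ∏ z : Fin 4 → ZMod n, (1 + K (fun i => D φ i z))))
  simp only [S_zero_comp_addRight, D_comp_addRight, prod_one_add_siteShift] at h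
  rw [show y + (x - y) = x by abel] at h
  exact h

/-- **The site sum is `|Λ|` times the one-point function at any site**:
`∫ (Σ_x G(∇φ(x))) e^{−S_0}∏(1+K) dφ = |Λ| · ∫ G(∇φ(x₀)) e^{−S_0}∏(1+K) dφ`, provided the site terms
are integrable. -/
theorem integral_sum_obs_mul_weight [NeZero n] (K G : (Fin 4 → ℝ) → ℂ) (x₀ : Fin 4 → ZMod n)
    (hint : ∀ x : Fin 4 → ZMod n, Integrable (fun φ : (Fin 4 → ZMod n) → ℝ => G (fun i => D φ i x) *
      (Complex.exp (-((S 0 φ : ℝ) : ℂ)) * ∏ z : Fin 4 → ZMod n, (1 + K (fun i => D φ i z))))) :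
    ∫ φ : (Fin 4 → ZMod n) → ℝ, (∑ x : Fin 4 → ZMod n, G (fun i => D φ i x)) *
        (Complex.exp (-((S 0 φ : ℝ) : ℂ)) * ∏ z : Fin 4 → ZMod n, (1 + K (fun i => D φ i z)))
      = (Fintype.card (Fin 4 → ZMod n) : ℂ) *
        ∫ φ : (Fin 4 → ZMod n) → ℝ, G (fun i => D φ i x₀) *
          (Complex.exp (-((S 0 φ : ℝ) : ℂ)) * ∏ z : Fin 4 → ZMod n, (1 + K (fun i => D φ i z))) := by
  simp only [Finset.sum_mul]
  rw [integral_finsetSum _ (fun x _ => hint x)]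
  rw [Finset.sum_congr rfl (fun x _ => integral_obs_mul_weight_eq K G x x₀)]
  rw [Finset.sum_const, Finset.card_univ, nsmul_eq_mul]

/-! ### The model's expectations through the perturbed partition-function integrals -/

/-- **`ev` through `pertZ`**: for the model's perturbation `𝒦_g = pertK g`,
`ev n g (G(∇φ(x))) = (∫ G(∇φ(x)) e^{−S_0}∏(1+𝒦_g) dφ) / pertZ n 𝒦_g`
(`w_{g,0} = e^{−S_0}∏(1+𝒦_g)`, `Z_n(g,0) = pertZ n 𝒦_g`). -/
theorem ev_gradObs_eq_div_pertZ [NeZero n] (g : ℝ) (G : (Fin 4 → ℝ) → ℂ) (x : Fin 4 → ZMod n) :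
    ev n g (fun φ => G (fun i => D φ i x))
      = (∫ φ : (Fin 4 → ZMod n) → ℝ, G (fun i => D φ i x) *
          (Complex.exp (-((S 0 φ : ℝ) : ℂ)) * ∏ z : Fin 4 → ZMod n, (1 + pertK g (fun i => D φ i z)))) /
        pertZ n (pertK g) := by
  unfold ev
  rw [pertZ_pertK]
  congr 1
  refine integral_congr_ae (Filter.Eventually.of_forall (fun φ => ?_))
  simp only [w_zero_eq_exp_mul_prod]

/-- **The model's one-point function is site independent**:
`ev n g (G(∇φ(x))) = ev n g (G(∇φ(y)))`. -/
theorem ev_gradObs_eq [NeZero n] (g : ℝ) (G : (Fin 4 → ℝ) → ℂ) (x y : Fin 4 → ZMod n) :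
    ev n g (fun φ => G (fun i => D φ i x)) = ev n g (fun φ => G (fun i => D φ i y)) := by
  rw [ev_gradObs_eq_div_pertZ, ev_gradObs_eq_div_pertZ, integral_obs_mul_weight_eq]

end Summit.HubbardSuperconductivity.HubbardSuperconductivity.Theorems.ComplexGFF

end
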